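import Summits.Parity.GeneralizedHardyLittlewood.Theorems.ModelHyperbolicity.Negative.ModelHyperbolicityMaclaurin

/-!
# `ModelHyperbolicity` (stmt-Parity-14110): THRESHOLD GROWTH — `x₀(u)^{1/u} → ∞`

Part 7 of the cdisprove seat's negative lemmas (gen-3 seat, crux cycle 2). The crux says: for every
`u ≥ 2` there is `x₀ = x₀(u)` with `P_{u,x}(z) = Σ_j A_j(x) z^j` real-rooted for all `x ≥ x₀`. Part 2
(`…UniformFalse`) proved `x₀(u) > 2^{u-1}`; gen-1/gen-2 numerics found `x₀(4) = 481`, `x₀(5,6,7) = 7^u`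
exactly and failures at `x = B^u − 1` for every prime `B ≤ 13` with `u ≤ 12`, and CONJECTURED that for
every `B` some stabilised Newton window fails. This file PROVES that conjecture, with no prime number
theory at all:

* input (part 6, `…Maclaurin`): `not_realRootedAt_of_maclaurin` — if `A_D > 0` is the top cell then
  real-rootedness forces `m! · A_{D−m} · A_D^{m−1} ≤ A_{D−1}^m` for every `2 ≤ m ≤ D − 1`.
* `cell_prime_pow_sub_one_le` — at `x = B^u − 1` (`B` prime) the second cell from the top is bounded
  UNIFORMLY in `u`: `A_{u−2}(B^u − 1) ≤ B^{B³+1}` (strip the `B`-part: the cofactor `m` has all prime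
  factors `≥ B + 1` and `(B+1)^{Ω(m)} ≤ m < B^{Ω(m)+2}`, so `Ω(m) < B³`; `n ↦ m` is injective on the cell),
  while `A_{u−1}(B^u − 1) ≥ 1` and `A_{u−1−m}(B^u − 1) ≥ 1` (`n = B^{u−1}, B^{u−1−m}`).
* `not_realRootedAt_prime_pow_sub_one` — hence, choosing `m` with `m! > (B^{B³+1})^m`
  (`exists_pow_lt_factorial`), `P_{u, B^u − 1}` is NOT real-rooted for every `u ≥ m + 2`.
* `threshold_ge_pow` — COROLLARY: for every `B` and all large `u`, every admissible threshold satisfies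
  `x₀(u) ≥ B^u`; i.e. `x₀(u)^{1/u} → ∞`. In particular the natural strengthening suggested by the data
  `x₀(5,6,7) = 7^u`, "an exponential threshold `x ≥ B^u` suffices" (`ModelHyperbolicityExpThreshold`),
  is FALSE (`not_modelHyperbolicityExpThreshold`), although it implies the crux.

Conceptual reason (docstring only): for fixed `B` the top cells at `x = B^u − 1` stabilise, as `u → ∞`,
to `c_d(B) = #{m : p ∣ m ⇒ p > B, m < B^{Ω(m)+d}}` — a Beurling-type count of generalised integers of
additive weight `Σ_{p^a ‖ m} a·log_B(p/B) < d` — so `Σ_d c_d(B) s^d` has radius of convergence `1/B`,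
whereas a coefficientwise limit of real-rooted polynomials with non-negative coefficients and bounded
`c_2/c_1` is an entire function of Laguerre–Pólya type. [folklore]
-/

namespace Summit.Parity.GeneralizedHardyLittlewood.Theorems.ModelHyperbolicity.Negative

open Summit.Parity.GeneralizedHardyLittlewood.Theses.LeeYangFibres
open Finset Polynomial
open scoped Classical Nat

/-! ## §H3 The cells at `x = B^u − 1`, `B` prime -/

/-- At `x = B^u − 1` the roughness condition `x^{1/u} < P⁻(n)` reads `B ≤ P⁻(n)`. -/
theorem cell_prime_pow_sub_one (B u : ℕ) (hB : 2 ≤ B) (hu : 0 < u) (j : ℕ) :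
    cell u (B ^ u - 1) j =
      ((Finset.Icc 1 (B ^ u - 1)).filter (fun n => B ≤ Nat.minFac n ∧ ArithmeticFunction.cardFactors n = j)).card := by
  have hBu : 0 < B ^ u := by positivity
  refine cell_eq_of_window (B := B) ?_ (Nat.sub_one_lt hBu.ne') hu j
  exact Nat.le_sub_one_of_lt (Nat.pow_lt_pow_left (by omega) hu.ne')

/-- `B^k` (with `1 ≤ k < u`) lies in the cell `A_k(B^u − 1)`: the top cells are non-empty. -/
theorem one_le_cell_prime_pow_sub_one {B u k : ℕ} (hB : B.Prime) (hk : 1 ≤ k) (hku : k < u) :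
    1 ≤ cell u (B ^ u - 1) k := by
  rw [cell_prime_pow_sub_one B u hB.two_le (by omega), Nat.one_le_iff_ne_zero, ← Nat.pos_iff_ne_zero,
    Finset.card_pos]
  refine ⟨B ^ k, Finset.mem_filter.mpr ⟨Finset.mem_Icc.mpr ⟨Nat.one_le_pow _ _ hB.pos, ?_⟩, ?_, ?_⟩⟩
  · exact Nat.le_sub_one_of_lt (Nat.pow_lt_pow_right hB.one_lt hku)
  · rw [Nat.pow_minFac (by omega), hB.minFac_eq]
  · exact ArithmeticFunction.cardFactors_apply_prime_pow hB

/-- `(B + k)·B^k ≤ B·(B+1)^k`. -/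
theorem add_mul_pow_le (B k : ℕ) : (B + k) * B ^ k ≤ B * (B + 1) ^ k := by
  induction k with
  | zero => simp
  | succ k ih =>
    have hpow : B ^ k ≤ (B + 1) ^ k := Nat.pow_le_pow_left (Nat.le_succ B) k
    calc (B + (k + 1)) * B ^ (k + 1) = ((B + k) * B ^ k) * B + B ^ k * B := by ring
      _ ≤ (B * (B + 1) ^ k) * B + (B + 1) ^ k * B := by gcongr
      _ = B * (B + 1) ^ (k + 1) := by ring

/-- Bernoulli consequence: `B^{k+2} < (B+1)^k` once `k ≥ B³` (and `B ≥ 1`). -/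
theorem pow_add_two_lt_succ_pow {B k : ℕ} (hB : 1 ≤ B) (hk : B ^ 3 ≤ k) : B ^ (k + 2) < (B + 1) ^ k := by
  have h := add_mul_pow_le B k
  have h1 : B * B ^ (k + 2) < B * (B + 1) ^ k := by
    calc B * B ^ (k + 2) = B ^ 3 * B ^ k := by ring
      _ ≤ k * B ^ k := Nat.mul_le_mul_right _ hk
      _ < (B + k) * B ^ k := by
          apply Nat.mul_lt_mul_of_lt_of_le (by omega) le_rfl (by positivity)
      _ ≤ B * (B + 1) ^ k := h
  exact Nat.lt_of_mul_lt_mul_left h1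

/-- If every prime factor of `m ≠ 0` is `≥ N` then `N^{Ω(m)} ≤ m`. -/
theorem pow_cardFactors_le_of_le_primeFactors {m N : ℕ} (hm : m ≠ 0)
    (h : ∀ q ∈ m.primeFactorsList, N ≤ q) : N ^ ArithmeticFunction.cardFactors m ≤ m := by
  rw [ArithmeticFunction.cardFactors_apply]
  conv_rhs => rw [← Nat.prod_primeFactorsList hm]
  exact List.pow_card_le_prod _ _ h

/-- UNIFORM BOUND for the second cell from the top at `x = B^u − 1` (`B` prime):
`A_{u−2}(B^u − 1) ≤ B^{B³+1}` for every `u ≥ 2`. Strip the `B`-part of `n`: the cofactor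
`m = n / B^{v_B(n)}` has all prime factors `≥ B + 1`, satisfies `(B+1)^{Ω(m)} ≤ m < B^{Ω(m)+2}`, hence
`Ω(m) < B³` and `m < B^{B³+1}`; and `n ↦ m` is injective on the cell (`v_B(n) = u − 2 − Ω(m)`). -/
theorem cell_prime_pow_sub_one_le {B u : ℕ} (hB : B.Prime) (hu : 2 ≤ u) :
    cell u (B ^ u - 1) (u - 2) ≤ B ^ (B ^ 3 + 1) := by
  rw [cell_prime_pow_sub_one B u hB.two_le (by omega)]
  set S := (Finset.Icc 1 (B ^ u - 1)).filter
    (fun n => B ≤ Nat.minFac n ∧ ArithmeticFunction.cardFactors n = u - 2) with hS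
  have hB1 : 1 < B := hB.one_lt
  -- the cofactor map
  let f : ℕ → ℕ := fun n => n / B ^ n.factorization B
  -- key facts about members of S
  have hmem : ∀ n ∈ S, n ≠ 0 ∧ B ^ n.factorization B * f n = n ∧
      ArithmeticFunction.cardFactors n = n.factorization B + ArithmeticFunction.cardFactors (f n) ∧
      n.factorization B + ArithmeticFunction.cardFactors (f n) + 2 = u ∧
      1 ≤ f n ∧ f n < B ^ (B ^ 3 + 1) := by
    intro n hn
    rw [hS, Finset.mem_filter, Finset.mem_Icc] at hn
    obtain ⟨⟨hn1, hnx⟩, hminFac, hΩ⟩ := hn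
    have hn0 : n ≠ 0 := by omega
    have hdecomp : B ^ n.factorization B * f n = n := Nat.ordProj_mul_ordCompl_eq_self n B
    have hf0 : f n ≠ 0 := (Nat.ordCompl_pos B hn0).ne'
    have hndvd : ¬ B ∣ f n := Nat.not_dvd_ordCompl hB hn0
    have hΩsplit : ArithmeticFunction.cardFactors n =
        n.factorization B + ArithmeticFunction.cardFactors (f n) := by
      conv_lhs => rw [← hdecomp]
      rw [ArithmeticFunction.cardFactors_mul (pow_ne_zero _ hB.ne_zero) hf0,
        ArithmeticFunction.cardFactors_apply_prime_pow hB]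
    have hu' : n.factorization B + ArithmeticFunction.cardFactors (f n) + 2 = u := by omega
    -- prime factors of the cofactor are ≥ B + 1
    have hprimes : ∀ q ∈ (f n).primeFactorsList, B + 1 ≤ q := by
      intro q hq
      have hqprime : q.Prime := Nat.prime_of_mem_primeFactorsList hq
      have hqdvd : q ∣ f n := Nat.dvd_of_mem_primeFactorsList hq
      have hqn : q ∣ n := hqdvd.trans ⟨B ^ n.factorization B, by rw [mul_comm]; exact hdecomp.symm⟩
      have h1 : B ≤ q := hminFac.trans (Nat.minFac_le_of_dvd hqprime.two_le hqn)
      have h2 : q ≠ B := fun h => hndvd (h ▸ hqdvd)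
      omega
    have hlow : (B + 1) ^ ArithmeticFunction.cardFactors (f n) ≤ f n :=
      pow_cardFactors_le_of_le_primeFactors hf0 hprimes
    -- m < B^(Ω m + 2)
    have hhigh : f n < B ^ (ArithmeticFunction.cardFactors (f n) + 2) := by
      have hlt : B ^ n.factorization B * f n < B ^ n.factorization B * B ^ (ArithmeticFunction.cardFactors (f n) + 2) := by
        rw [hdecomp, ← pow_add, show n.factorization B + (ArithmeticFunction.cardFactors (f n) + 2) = u by omega]
        have : 0 < B ^ u := by positivity
        omega
      exact Nat.lt_of_mul_lt_mul_left hlt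
    -- hence Ω m < B³
    have hΩm : ArithmeticFunction.cardFactors (f n) < B ^ 3 := by
      by_contra hge
      push Not at hge
      have := pow_add_two_lt_succ_pow (le_of_lt hB1) hge
      omega
    refine ⟨hn0, hdecomp, hΩsplit, hu', Nat.one_le_iff_ne_zero.mpr hf0, ?_⟩
    calc f n < B ^ (ArithmeticFunction.cardFactors (f n) + 2) := hhigh
      _ ≤ B ^ (B ^ 3 + 1) := Nat.pow_le_pow_right hB.pos (by omega)
  -- f maps S into Icc 1 M and is injective on S
  have hmaps : Set.MapsTo f (S : Set ℕ) (Finset.Icc 1 (B ^ (B ^ 3 + 1)) : Set ℕ) := by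
    intro n hn
    obtain ⟨-, -, -, -, h1, h2⟩ := hmem n hn
    simp only [Finset.coe_Icc, Set.mem_Icc]
    exact ⟨h1, h2.le⟩
  have hinj : Set.InjOn f (S : Set ℕ) := by
    intro n₁ h₁ n₂ h₂ heq
    obtain ⟨-, hd₁, -, hu₁, -, -⟩ := hmem n₁ h₁
    obtain ⟨-, hd₂, -, hu₂, -, -⟩ := hmem n₂ h₂
    have heq' : f n₁ = f n₂ := heq
    have ha : n₁.factorization B = n₂.factorization B := by
      rw [heq'] at hu₁
      omega
    rw [← hd₁, ← hd₂, ha, heq']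
  calc S.card ≤ (Finset.Icc 1 (B ^ (B ^ 3 + 1))).card := Finset.card_le_card_of_injOn f hmaps hinj
    _ = B ^ (B ^ 3 + 1) := by rw [Nat.card_Icc]; omega

/-- Factorials beat powers: for every `M` there is `m ≥ 2` with `M^m < m!`. -/
theorem exists_pow_lt_factorial (M : ℕ) : ∃ m : ℕ, 2 ≤ m ∧ M ^ m < m ! := by
  rcases Nat.eq_zero_or_pos M with rfl | hM
  · exact ⟨2, le_rfl, by decide⟩
  set k := 2 * M + 2 with hk
  set n := M ^ k with hn
  refine ⟨k + n, by omega, ?_⟩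
  have hn2 : M ^ k < 2 ^ n := hn ▸ Nat.lt_two_pow_self
  have hMn : 0 < M ^ n := by positivity
  calc M ^ (k + n) = M ^ k * M ^ n := pow_add _ _ _
    _ < 2 ^ n * M ^ n := Nat.mul_lt_mul_of_lt_of_le hn2 le_rfl hMn
    _ = (2 * M) ^ n := (mul_pow _ _ _).symm
    _ ≤ (k + 1) ^ n := Nat.pow_le_pow_left (by omega) _
    _ ≤ k ! * (k + 1) ^ n := Nat.le_mul_of_pos_left _ (Nat.factorial_pos k)
    _ ≤ (k + n)! := Nat.factorial_mul_pow_le_factorial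

/-! ## §H4 Threshold growth -/

/-- THRESHOLD GROWTH at prime bases: for every prime `B`, `P_{u, B^u − 1}` is not real-rooted for all
large `u`. -/
theorem not_realRootedAt_prime_pow_sub_one {B : ℕ} (hB : B.Prime) :
    ∃ u₀ : ℕ, ∀ u : ℕ, u₀ ≤ u → ¬ RealRootedAt u (B ^ u - 1) := by
  obtain ⟨m, hm2, hm⟩ := exists_pow_lt_factorial (B ^ (B ^ 3 + 1))
  refine ⟨m + 2, fun u hu => ?_⟩
  refine not_realRootedAt_of_maclaurin (D := u - 1) (m := m) hm2 (by omega) ?_ ?_ ?_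
  · intro j hj
    exact cell_eq_zero_of_le (by omega) (by omega)
  · exact one_le_cell_prime_pow_sub_one hB (by omega) (by omega)
  · have hbd : cell u (B ^ u - 1) (u - 1 - 1) ≤ B ^ (B ^ 3 + 1) := by
      rw [show u - 1 - 1 = u - 2 by omega]
      exact cell_prime_pow_sub_one_le hB (by omega)
    have h1 : 1 ≤ cell u (B ^ u - 1) (u - 1 - m) := one_le_cell_prime_pow_sub_one hB (by omega) (by omega)
    have h2 : 1 ≤ cell u (B ^ u - 1) (u - 1) ^ (m - 1) :=
      Nat.one_le_pow _ _ (one_le_cell_prime_pow_sub_one hB (by omega) (by omega))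
    calc cell u (B ^ u - 1) (u - 1 - 1) ^ m ≤ (B ^ (B ^ 3 + 1)) ^ m := Nat.pow_le_pow_left hbd m
      _ < m ! := hm
      _ = m ! * 1 * 1 := by ring
      _ ≤ m ! * cell u (B ^ u - 1) (u - 1 - m) * cell u (B ^ u - 1) (u - 1) ^ (m - 1) :=
          Nat.mul_le_mul (Nat.mul_le_mul_left _ h1) h2

/-- THRESHOLD GROWTH: for every `B` and all large `u`, any `x₀` that serves the crux at level `u`
satisfies `B^u ≤ x₀`; in other words `x₀(u)^{1/u} → ∞`. -/
theorem threshold_ge_pow (B : ℕ) :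
    ∃ u₀ : ℕ, ∀ u : ℕ, u₀ ≤ u → ∀ x₀ : ℕ, (∀ x : ℕ, x₀ ≤ x → RealRootedAt u x) → B ^ u ≤ x₀ := by
  obtain ⟨p, hBp, hp⟩ := Nat.exists_infinite_primes B
  obtain ⟨u₀, hu₀⟩ := not_realRootedAt_prime_pow_sub_one hp
  refine ⟨u₀, fun u hu x₀ hx₀ => ?_⟩
  by_contra hlt
  push Not at hlt
  have hle : B ^ u ≤ p ^ u := Nat.pow_le_pow_left hBp u
  exact hu₀ u hu (hx₀ _ (by omega))

/-- The natural strengthening "an exponential threshold suffices": `∃ B, ∀ u ≥ 2, ∀ x ≥ B^u, RealRootedAt u x`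
(suggested by the exact data `x₀(5) = 7^5, x₀(6) = 7^6, x₀(7) = 7^7`). -/
def ModelHyperbolicityExpThreshold : Prop :=
  ∃ B : ℕ, ∀ u : ℕ, 2 ≤ u → ∀ x : ℕ, B ^ u ≤ x → RealRootedAt u x

/-- It does imply the crux … -/
theorem modelHyperbolicity_of_expThreshold : ModelHyperbolicityExpThreshold → ModelHyperbolicity :=
  fun ⟨B, h⟩ u hu => ⟨B ^ u, h u hu⟩

/-- … but it is FALSE: no exponential threshold `B^u` serves all large `u`. -/
theorem not_modelHyperbolicityExpThreshold : ¬ ModelHyperbolicityExpThreshold := by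
  rintro ⟨B, h⟩
  obtain ⟨u₀, hu₀⟩ := threshold_ge_pow (B + 1)
  set u := max u₀ 2 with hu
  have hge : (B + 1) ^ u ≤ B ^ u := hu₀ u (le_max_left _ _) (B ^ u) (h u (le_max_right _ _))
  have hlt : B ^ u < (B + 1) ^ u := Nat.pow_lt_pow_left (Nat.lt_succ_self B) (by omega)
  omega

end Summit.Parity.GeneralizedHardyLittlewood.Theorems.ModelHyperbolicity.Negative
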